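import Summits.QuantumFields.YangMills.Theorems.SwapVirialDeficitZeroModeGroupFourSmallBallDominator
import HarnessLib

/-!
# Exact zero-mode rung, FOUR pairwise nearly commuting letters — V: the per-`κ` LIMIT of the two-scale family (dominated convergence)
# (zero-mode block of crux ⟨stmt-QuantumFields-24497⟩ `ToronTubeVolumeLaw`; free-hands support of ⟨stmt-QuantumFields-24197⟩ / ⟨24497⟩)

Along the hub family of part III the three parameters are tied as `(η, ζ, κ) = (η, κη, κ)` (`η = ‖Im a‖²/‖a‖²`, `κ = t²‖a‖⁴/(4‖Im a‖⁴)`).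
This file proves the first analytic step of the logarithm law: for every `κ ≥ 0`,
★★★ `tendsto_volume_twoScale : vol³(T(η, κη, κ)) → h(κ) := vol³(T(0, 0, κ))` as `η → 0⁺`,
by dominated convergence (Mathlib's `tendsto_measure_of_ae_tendsto_indicator`) with the majorant `domSet4` of parts IV-a/b/c:
* §18 the boundary of the limit event `T(0, 0, κ)` is `vol³`-null — each of its nine bounding hypersurfaces is a quadratic equation in ONE real
  part (`x₀² = 1`, `x₀² = x_J² + x_K²`, `y₀² = pairK/x₀²`), hence null by ✓`volume_re_sq_eq_null'` (K3 part III), ✓`volume_re_eq_zero` (SU2HaarChart) and Fubini; lifted to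
  `(ℍ × ℍ) × ℍ` along the quasi-measure-preserving letter / pair projections;
* §19 ★ `mem_twoScale_eventually_iff` — off that boundary, membership of `w` in `T(η, κη, κ)` is eventually (in `η → 0⁺`) its membership in
  `T(0, 0, κ)` (persistence of strict inequalities, ✓`eventually_lt_iff_of_ne` / ✓`eventually_le_iff_of_ne`);
* §20 ★★★ the limit, and `h(κ) ≤ h(0) < ∞`, `h` antitone.
What remains for `N₄(t) = w₄·t⁶·log(1/t)·(1 + o(1))`: the modulus of `h` at `κ → 0⁺` and its decay at `κ → ∞`, uniformity of §20 in `κ`, and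
the radial disintegration of the cone measure (`∫ ‖a‖³‖Im a‖⁻³ … dcone = ∫ d‖Im a‖/‖Im a‖ …`).
HONEST LABEL: finite-dimensional measure theory on `SU(2)⁴` (plan-level zero-mode rung of DRAFT lines); NOT ⟨24497⟩, NOT ⟨24197⟩; the Yang–Mills mass gap
is NOT proved; no summit is proved by a line.  Seat ym-line-fcl-p3 g44 (cell ym-idea-1, free hands), `--supports stmt-QuantumFields-24197`.  Standard axioms
(one auxiliary def `pairK`).  References: [cite: GonzalezarroyoAltes1988]; [cite: Vanbaal2001]; [cite: Luscher1983, §2]; [folklore].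
-/

set_option autoImplicit false

noncomputable section

open MeasureTheory Quaternion Set Filter Topology
open scoped Quaternion ENNReal BigOperators
open Literature.MathematicalPhysics.QuantumLattice
open Summit.QuantumFields.YangMills.Theorems.SwapTwistDeficit.ToronLog

attribute [local instance] Literature.Analysis.FluidPDE.Tao2016.quatMeasurableSpace
  Literature.Analysis.FluidPDE.Tao2016.quatBorelSpace
  Literature.MathematicalPhysics.QuantumLattice.secondCountableTopology_su2

namespace Summit.QuantumFields.YangMills.Theorems.SwapVirialDeficit.ZeroModeGroup

/-! ## §18 The boundary of the limit event is null -/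

/-- The `κ`-pair functional of the limit event: `pairSq x y + κ·(x_Jy_K − x_Ky_J)²`. [folklore] -/
def pairK (κ : ℝ) (x y : ℍ) : ℝ := pairSq x y + κ * (x.imJ * y.imK - x.imK * y.imJ) ^ 2

/-- Unfolding `pairK`. [folklore] -/
theorem pairK_def (κ : ℝ) (x y : ℍ) :
    pairK κ x y = (x.imK * y.imI - x.imI * y.imK) ^ 2 + (x.imI * y.imJ - x.imJ * y.imI) ^ 2 + κ * (x.imJ * y.imK - x.imK * y.imJ) ^ 2 := rfl

/-- `pairK κ` is jointly continuous. [folklore] -/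
theorem continuous_pairK (κ : ℝ) : Continuous fun p : ℍ × ℍ => pairK κ p.1 p.2 := by
  unfold pairK
  have hJ1 : Continuous fun p : ℍ × ℍ => p.1.imJ := Quaternion.continuous_imJ.comp continuous_fst
  have hK1 : Continuous fun p : ℍ × ℍ => p.1.imK := Quaternion.continuous_imK.comp continuous_fst
  have hJ2 : Continuous fun p : ℍ × ℍ => p.2.imJ := Quaternion.continuous_imJ.comp continuous_snd
  have hK2 : Continuous fun p : ℍ × ℍ => p.2.imK := Quaternion.continuous_imK.comp continuous_snd
  exact continuous_pairSq.add (continuous_const.mul (((hJ1.mul hK2).sub (hK1.mul hJ2)).pow 2))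

/-- (b) The ball boundary `{x | x₀² = 1}` is null. [folklore] -/
theorem volume_re_sq_eq_one_null : (volume : Measure ℍ) {x : ℍ | x.re ^ 2 = 1} = 0 :=
  volume_re_sq_eq_null' (G := fun _ => (1 : ℝ)) (g := fun _ => (1 : ℝ)) measurable_const fun _ => rfl

/-- (h) The hub boundary `{x | x_J² + x_K² = x₀²}` is null. [folklore] -/
theorem volume_tvSq_eq_re_sq_null : (volume : Measure ℍ) {x : ℍ | tvSq x = x.re ^ 2} = 0 := by
  obtain ⟨-, m1, m2⟩ := measurable_fin3
  have e : {x : ℍ | tvSq x = x.re ^ 2} = {x : ℍ | x.re ^ 2 = (fun x : ℍ => tvSq x) x} := by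
    ext x; simp only [Set.mem_setOf_eq]; exact eq_comm
  rw [e]
  exact volume_re_sq_eq_null' (g := fun v => v 1 ^ 2 + v 2 ^ 2) ((m1.pow_const 2).add (m2.pow_const 2)) fun x => by simp [tvSq]

/-- (p) The pair boundary, `y`-section at a letter `x` with `x₀ ≠ 0`: `{y | pairK κ x y = x₀²·y₀²}` is null. [folklore] -/
theorem volume_pairK_boundary_section_null (κ : ℝ) {x : ℍ} (hx : x.re ≠ 0) :
    (volume : Measure ℍ) {y : ℍ | pairK κ x y = x.re ^ 2 * y.re ^ 2} = 0 := by
  obtain ⟨m0, m1, m2⟩ := measurable_fin3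
  have hx2 : x.re ^ 2 ≠ 0 := pow_ne_zero 2 hx
  have e : {y : ℍ | pairK κ x y = x.re ^ 2 * y.re ^ 2} = {y : ℍ | y.re ^ 2 = (fun y : ℍ => pairK κ x y / x.re ^ 2) y} := by
    ext y; simp only [Set.mem_setOf_eq]
    constructor
    · intro h; field_simp; linarith
    · intro h; field_simp at h; linarith
  rw [e]
  exact volume_re_sq_eq_null'
    (g := fun v => ((x.imK * v 0 - x.imI * v 2) ^ 2 + (x.imI * v 1 - x.imJ * v 0) ^ 2 + κ * (x.imJ * v 2 - x.imK * v 1) ^ 2) / x.re ^ 2)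
    ((((((m0.const_mul _).sub (m2.const_mul _)).pow_const 2).add (((m1.const_mul _).sub (m0.const_mul _)).pow_const 2)).add
      ((((m2.const_mul _).sub (m1.const_mul _)).pow_const 2).const_mul κ)).div_const _)
    fun y => by simp [pairK, pairSq]

/-- The pair boundary is measurable in `(x, y)`. [folklore] -/
theorem measurableSet_pairK_ne (κ : ℝ) : MeasurableSet {q : ℍ × ℍ | pairK κ q.1 q.2 ≠ q.1.re ^ 2 * q.2.re ^ 2} :=
  (measurableSet_eq_fun (continuous_pairK κ).measurable
    (((Quaternion.continuous_re.measurable.comp measurable_fst).pow_const 2).mul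
      ((Quaternion.continuous_re.measurable.comp measurable_snd).pow_const 2))).compl

/-- ★ The pair boundary is `(vol ⊗ vol)`-null: a.e. `(x, y)` has `pairK κ x y ≠ x₀²y₀²`. [folklore] -/
theorem ae_pairK_ne (κ : ℝ) :
    ∀ᵐ q : ℍ × ℍ ∂((volume : Measure ℍ).prod (volume : Measure ℍ)), pairK κ q.1 q.2 ≠ q.1.re ^ 2 * q.2.re ^ 2 := by
  have h := (Measure.ae_prod_mem_iff_ae_ae_mem (μ := (volume : Measure ℍ)) (ν := (volume : Measure ℍ)) (measurableSet_pairK_ne κ)).2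
  refine h ?_
  have hre : ∀ᵐ x : ℍ ∂(volume : Measure ℍ), x.re ≠ 0 := by
    rw [ae_iff]; simpa only [ne_eq, not_not] using Literature.MathematicalPhysics.QuantumLattice.volume_re_eq_zero
  filter_upwards [hre] with x hx
  rw [ae_iff]
  simpa only [Set.mem_setOf_eq, ne_eq, not_not] using volume_pairK_boundary_section_null κ hx

/-- ★★ **The boundary of `T(0, 0, κ)` is `vol³`-null**: a.e. `w = ((x, y), z)` satisfies the nine non-degeneracy conditions. [folklore] -/
theorem ae_not_boundary4 (κ : ℝ) :
    ∀ᵐ w : (ℍ × ℍ) × ℍ ∂(((volume : Measure ℍ).prod (volume : Measure ℍ)).prod (volume : Measure ℍ)),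
      (w.1.1.re ^ 2 ≠ 1 ∧ w.1.2.re ^ 2 ≠ 1 ∧ w.2.re ^ 2 ≠ 1) ∧
      (tvSq w.1.1 ≠ w.1.1.re ^ 2 ∧ tvSq w.1.2 ≠ w.1.2.re ^ 2 ∧ tvSq w.2 ≠ w.2.re ^ 2) ∧
      (pairK κ w.1.1 w.1.2 ≠ w.1.1.re ^ 2 * w.1.2.re ^ 2 ∧ pairK κ w.1.1 w.2 ≠ w.1.1.re ^ 2 * w.2.re ^ 2 ∧
        pairK κ w.1.2 w.2 ≠ w.1.2.re ^ 2 * w.2.re ^ 2) := by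
  -- single-letter facts
  have hb : ∀ᵐ x : ℍ ∂(volume : Measure ℍ), x.re ^ 2 ≠ 1 := by
    rw [ae_iff]; simpa only [ne_eq, not_not] using volume_re_sq_eq_one_null
  have hh : ∀ᵐ x : ℍ ∂(volume : Measure ℍ), tvSq x ≠ x.re ^ 2 := by
    rw [ae_iff]; simpa only [ne_eq, not_not] using volume_tvSq_eq_re_sq_null
  -- the projections
  have qx : Measure.QuasiMeasurePreserving (fun w : (ℍ × ℍ) × ℍ => w.1.1)
      (((volume : Measure ℍ).prod (volume : Measure ℍ)).prod (volume : Measure ℍ)) volume :=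
    Measure.quasiMeasurePreserving_fst.comp Measure.quasiMeasurePreserving_fst
  have qy : Measure.QuasiMeasurePreserving (fun w : (ℍ × ℍ) × ℍ => w.1.2)
      (((volume : Measure ℍ).prod (volume : Measure ℍ)).prod (volume : Measure ℍ)) volume :=
    Measure.quasiMeasurePreserving_snd.comp Measure.quasiMeasurePreserving_fst
  have qz : Measure.QuasiMeasurePreserving (fun w : (ℍ × ℍ) × ℍ => w.2)
      (((volume : Measure ℍ).prod (volume : Measure ℍ)).prod (volume : Measure ℍ)) volume :=
    Measure.quasiMeasurePreserving_snd
  have qxy : Measure.QuasiMeasurePreserving (fun w : (ℍ × ℍ) × ℍ => w.1)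
      (((volume : Measure ℍ).prod (volume : Measure ℍ)).prod (volume : Measure ℍ)) ((volume : Measure ℍ).prod (volume : Measure ℍ)) :=
    Measure.quasiMeasurePreserving_fst
  have qxz : Measure.QuasiMeasurePreserving (Prod.map Prod.fst id : (ℍ × ℍ) × ℍ → ℍ × ℍ)
      (((volume : Measure ℍ).prod (volume : Measure ℍ)).prod (volume : Measure ℍ)) ((volume : Measure ℍ).prod (volume : Measure ℍ)) :=
    MeasureTheory.QuasiMeasurePreserving.prodMap Measure.quasiMeasurePreserving_fst (Measure.QuasiMeasurePreserving.id _)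
  have qyz : Measure.QuasiMeasurePreserving (Prod.map Prod.snd id : (ℍ × ℍ) × ℍ → ℍ × ℍ)
      (((volume : Measure ℍ).prod (volume : Measure ℍ)).prod (volume : Measure ℍ)) ((volume : Measure ℍ).prod (volume : Measure ℍ)) :=
    MeasureTheory.QuasiMeasurePreserving.prodMap Measure.quasiMeasurePreserving_snd (Measure.QuasiMeasurePreserving.id _)
  have hp := ae_pairK_ne κ
  filter_upwards [qx.ae hb, qy.ae hb, qz.ae hb, qx.ae hh, qy.ae hh, qz.ae hh, qxy.ae hp, qxz.ae hp, qyz.ae hp]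
    with w b1 b2 b3 h1 h2 h3 p1 p2 p3
  exact ⟨⟨b1, b2, b3⟩, ⟨h1, h2, h3⟩, ⟨p1, p2, p3⟩⟩

/-! ## §19 Off the boundary the indicator is eventually constant -/

/-- `η ↦ M_{η, κη}(x)` is continuous. [folklore] -/
theorem continuous_tsNorm_param (κ : ℝ) (x : ℍ) : Continuous fun η : ℝ => tsNorm η (κ * η) x := by
  unfold tsNorm; fun_prop

/-- Ball constraint: eventually decided at `η = 0`. [folklore] -/
theorem eventually_ball_iff (κ : ℝ) {x : ℍ} (h : x.re ^ 2 ≠ 1) :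
    ∀ᶠ η in 𝓝[>] (0 : ℝ), (tsNorm η (κ * η) x < 1 ↔ tsNorm 0 0 x < 1) := by
  have h0 : (fun η : ℝ => tsNorm η (κ * η) x) 0 ≠ (fun _ : ℝ => (1 : ℝ)) 0 := by
    simp only [mul_zero, tsNorm_zero_zero]; exact h
  refine (eventually_lt_iff_of_ne (continuous_tsNorm_param κ x) continuous_const h0).mono fun η hη => ?_
  simp only [mul_zero] at hη
  exact hη

/-- Hub constraint: eventually decided at `η = 0`. [folklore] -/
theorem eventually_hub_iff (κ : ℝ) {x : ℍ} (h : tvSq x ≠ x.re ^ 2) :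
    ∀ᶠ η in 𝓝[>] (0 : ℝ), (x.imJ ^ 2 + x.imK ^ 2 ≤ tsNorm η (κ * η) x ↔ x.imJ ^ 2 + x.imK ^ 2 ≤ tsNorm 0 0 x) := by
  have h0 : (fun _ : ℝ => x.imJ ^ 2 + x.imK ^ 2) 0 ≠ (fun η : ℝ => tsNorm η (κ * η) x) 0 := by
    simp only [mul_zero, tsNorm_zero_zero]; exact h
  refine (eventually_le_iff_of_ne continuous_const (continuous_tsNorm_param κ x) h0).mono fun η hη => ?_
  simp only [mul_zero] at hη
  exact hη

/-- Pair constraint: eventually decided at `η = 0`. [folklore] -/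
theorem eventually_pair_iff (κ : ℝ) {x y : ℍ} (h : pairK κ x y ≠ x.re ^ 2 * y.re ^ 2) :
    ∀ᶠ η in 𝓝[>] (0 : ℝ),
      ((x.imK * y.imI - x.imI * y.imK) ^ 2 + (x.imI * y.imJ - x.imJ * y.imI) ^ 2 + κ * (x.imJ * y.imK - x.imK * y.imJ) ^ 2 ≤
          tsNorm η (κ * η) x * tsNorm η (κ * η) y ↔
        (x.imK * y.imI - x.imI * y.imK) ^ 2 + (x.imI * y.imJ - x.imJ * y.imI) ^ 2 + κ * (x.imJ * y.imK - x.imK * y.imJ) ^ 2 ≤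
          tsNorm 0 0 x * tsNorm 0 0 y) := by
  have h0 : (fun _ : ℝ => (x.imK * y.imI - x.imI * y.imK) ^ 2 + (x.imI * y.imJ - x.imJ * y.imI) ^ 2 + κ * (x.imJ * y.imK - x.imK * y.imJ) ^ 2) 0 ≠
      (fun η : ℝ => tsNorm η (κ * η) x * tsNorm η (κ * η) y) 0 := by
    simp only [mul_zero, tsNorm_zero_zero]; exact h
  refine (eventually_le_iff_of_ne continuous_const ((continuous_tsNorm_param κ x).mul (continuous_tsNorm_param κ y)) h0).mono fun η hη => ?_
  simp only [Pi.mul_apply, mul_zero] at hη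
  exact hη

/-- ★ **Eventual constancy off the boundary**: if at `w = ((x, y), z)` none of the nine bounding equations of `T(0, 0, κ)` holds, then
`w ∈ T(η, κη, κ) ↔ w ∈ T(0, 0, κ)` for all small `η > 0`. [folklore] -/
theorem mem_twoScale_eventually_iff (κ : ℝ) (w : (ℍ × ℍ) × ℍ)
    (hw : (w.1.1.re ^ 2 ≠ 1 ∧ w.1.2.re ^ 2 ≠ 1 ∧ w.2.re ^ 2 ≠ 1) ∧
      (tvSq w.1.1 ≠ w.1.1.re ^ 2 ∧ tvSq w.1.2 ≠ w.1.2.re ^ 2 ∧ tvSq w.2 ≠ w.2.re ^ 2) ∧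
      (pairK κ w.1.1 w.1.2 ≠ w.1.1.re ^ 2 * w.1.2.re ^ 2 ∧ pairK κ w.1.1 w.2 ≠ w.1.1.re ^ 2 * w.2.re ^ 2 ∧
        pairK κ w.1.2 w.2 ≠ w.1.2.re ^ 2 * w.2.re ^ 2)) :
    ∀ᶠ η in 𝓝[>] (0 : ℝ), (w ∈ twoScaleSet4 η (κ * η) κ ↔ w ∈ twoScaleSet4 0 0 κ) := by
  obtain ⟨⟨x, y⟩, z⟩ := w
  obtain ⟨⟨b1, b2, b3⟩, ⟨h1, h2, h3⟩, ⟨p1, p2, p3⟩⟩ := hw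
  filter_upwards [eventually_ball_iff κ b1, eventually_ball_iff κ b2, eventually_ball_iff κ b3, eventually_hub_iff κ h1, eventually_hub_iff κ h2,
    eventually_hub_iff κ h3, eventually_pair_iff κ p1, eventually_pair_iff κ p2, eventually_pair_iff κ p3] with η k1 k2 k3 k4 k5 k6 k7 k8 k9
  simp only [twoScaleSet4, Set.mem_setOf_eq]
  rw [k1, k2, k3, k4, k5, k6, k7, k8, k9]

/-! ## §20 The limit by dominated convergence -/

/-- For `η > 0` (and `κ ≥ 0`) the event lies in the majorant. [folklore] -/
theorem eventually_twoScale_subset_domSet4 {κ : ℝ} (hκ : 0 ≤ κ) :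
    ∀ᶠ η in 𝓝[>] (0 : ℝ), twoScaleSet4 η (κ * η) κ ⊆ domSet4 := by
  filter_upwards [self_mem_nhdsWithin] with η hη
  exact twoScaleSet4_subset_domSet4 (le_of_lt hη) (mul_nonneg hκ (le_of_lt hη)) hκ

/-- ★★★ **THE PER-`κ` LIMIT OF THE TWO-SCALE FAMILY**: for `κ ≥ 0`, `vol³(T(η, κη, κ)) → h(κ) = vol³(T(0, 0, κ))` as `η → 0⁺`
(dominated convergence with the finite-volume majorant `domSet4`; the indicator converges off the null boundary). [folklore] -/
theorem tendsto_volume_twoScale {κ : ℝ} (hκ : 0 ≤ κ) :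
    Tendsto (fun η : ℝ => (((volume : Measure ℍ).prod (volume : Measure ℍ)).prod (volume : Measure ℍ)) (twoScaleSet4 η (κ * η) κ))
      (𝓝[>] (0 : ℝ)) (𝓝 ((((volume : Measure ℍ).prod (volume : Measure ℍ)).prod (volume : Measure ℍ)) (twoScaleSet4 0 0 κ))) := by
  refine tendsto_measure_of_ae_tendsto_indicator (𝓝[>] (0 : ℝ)) (measurableSet_twoScaleSet4 0 0 κ)
    (fun η => measurableSet_twoScaleSet4 η (κ * η) κ) measurableSet_domSet4 volume_domSet4_lt_top.ne (eventually_twoScale_subset_domSet4 hκ) ?_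
  filter_upwards [ae_not_boundary4 κ] with w hw using mem_twoScale_eventually_iff κ w hw

/-- `h(κ) ≤ h(0)` for `κ ≥ 0` (the limit events decrease in `κ`). [folklore] -/
theorem volume_twoScale_limit_le_zero {κ : ℝ} (hκ : 0 ≤ κ) :
    (((volume : Measure ℍ).prod (volume : Measure ℍ)).prod (volume : Measure ℍ)) (twoScaleSet4 0 0 κ) ≤
      (((volume : Measure ℍ).prod (volume : Measure ℍ)).prod (volume : Measure ℍ)) (twoScaleSet4 0 0 0) :=
  measure_mono (twoScaleSet4_zero_antitone hκ)

/-- `κ ↦ h(κ)` is antitone on `[0, ∞)` (indeed on all of `ℝ`). [folklore] -/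
theorem antitone_volume_twoScale_limit :
    Antitone fun κ : ℝ => (((volume : Measure ℍ).prod (volume : Measure ℍ)).prod (volume : Measure ℍ)) (twoScaleSet4 0 0 κ) :=
  fun _ _ h => measure_mono (twoScaleSet4_zero_antitone h)

/-- ★★ The limit volumes are finite: `h(κ) < ∞` for `κ ≥ 0`. [folklore] -/
theorem volume_twoScale_limit_lt_top {κ : ℝ} (hκ : 0 ≤ κ) :
    (((volume : Measure ℍ).prod (volume : Measure ℍ)).prod (volume : Measure ℍ)) (twoScaleSet4 0 0 κ) < ⊤ :=
  volume_twoScaleSet4_lt_top le_rfl le_rfl hκ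

end Summit.QuantumFields.YangMills.Theorems.SwapVirialDeficit.ZeroModeGroup

end
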